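import Summits.QuantumAdvantage.QuantumAdvantage.Theorems.CubicForrelationNearExactIsExactTwelveTypeO768OddCount2932

/-!
# Crux `CubicForrelation.NearExactIsExact` (stmt-QuantumAdvantage-14043) — n = 12, type O with base set `768` AT `Φ = 29/32`: the wild
  function is RIGID — exactly `128` wild points, all of height `v = ±1` inside `E` with `τ₀ = −3v` (the boundary budget makes gen 15's count tight)

Certificate seat `b2b-cforr-cert` (gen 22).  HONEST FRAMING: a kernel-checked structure lemma (standard axioms, no `decide`) about cubic Boolean pairs
on 12 bits — from `to22_typeO_E768_ge2932_oddcount` (…TwelveTypeO768OddCount2932: at least `128` points with `v` odd) and the exact excess budget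
`Σ X = 2¹⁷(1 − 29/32) − 10240 = 2048 = 128·16` (each odd point costs `≥ 16`): exactly `128` wild points, each of cost exactly `16`, i.e. `v = ±1`
with `τ₀ = −3v` (inside `E`, `v = (−1)^{d₁}`), and `v = 0` elsewhere.  Input of …TwelveTypeO768DeadAt2932.  Nothing is closed here.  NO new value
of `θ₁₂`.  NOT summit progress.

References: Ax (1964); McEliece (1972); Kasami–Tokura (1970); MacWilliams–Sloane (1977) Ch. 15; Carlet (2021) §4.1, §5.  Axioms: standard.
-/

set_option linter.dupNamespace false -- D-0017: single-problem summit ⇒ `QuantumAdvantage.QuantumAdvantage` by design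

noncomputable section

namespace Summit.QuantumAdvantage.QuantumAdvantage.Theorems.CubicForrelation.NearExactIsExact

open Finset
open Literature.Computability.QuantumComplexity
open Literature.Computability.QuantumComplexity.BuzetChailloux (bxor zeroVec bxor_bxor_cancel_left bxor_zeroVec zeroVec_bxor bxor_comm
  bxor_self twist_zeroVec_right twist_bxor_right)
open Literature.Computability.QuantumComplexity.Simon (twist_eq_one_or)
open Literature.Computability.QuantumComplexity.DerivativeWalsh (W twist_bxor_left)
open Summit.QuantumAdvantage.QuantumAdvantage.Theorems.NearExactIsExact.Negative (TypeOTwelve.typeO_of_exists_odd)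

/-- **Type O, `#E = 768`, `Φ ≥ 29/32` on 12 bits: the wild function has exactly `128` wild points, all of height `±1` with `τ₀ = −3v`.**
(The boundary budget `Σ X = 2048 = 128·16` makes gen 15's count tight.)  Finite-slice statement; NOT summit progress. [this work] -/
theorem to22_typeO_E768_ge2932_wild (f g : (Fin (6 + 6) → Bool) → Bool) (hf : IsDegLeFun 3 f) (hg : IsDegLeFun 3 g)
    (u : (Fin (6 + 6) → Bool) → ℤ) (hu : ∀ x, W (fun y => signOf (g y)) x = (2 : ℝ) ^ 4 * (u x : ℝ))
    (hodd : ∃ x, Odd (u x)) (hE : #(univ.filter fun x : Fin (6 + 6) → Bool => (Odd (u x / 2) ↔ Odd (u x / 2 / 2))) = 768)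
    (hΦ : (29 / 32 : ℝ) ≤ forrelation f g) :
    forrelation f g = 29 / 32 ∧ ∃ v : (Fin (6 + 6) → Bool) → ℤ,
      (∀ x, u x - 4 * sZ (f x) =
        sZ (decide (Odd (u x / 2))) * (1 - 4 * (if (Odd (u x / 2) ↔ Odd (u x / 2 / 2)) then 1 else 0)) + 8 * v x) ∧
      (∀ x, v x = 0 ∨ ((v x = 1 ∨ v x = -1) ∧
        sZ (decide (Odd (u x / 2))) * (1 - 4 * (if (Odd (u x / 2) ↔ Odd (u x / 2 / 2)) then 1 else 0)) = -3 * v x)) ∧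
      #(univ.filter fun x => v x ≠ 0) = 128 := by
  classical
  obtain ⟨hΦeq, v, hvx, hO128⟩ := to22_typeO_E768_ge2932_oddcount f g hf hg u hu hodd hE hΦ
  have hall : ∀ x, Odd (u x) := TypeOTwelve.typeO_of_exists_odd g u hg hu hodd
  set τ₀ : (Fin (6 + 6) → Bool) → ℤ := fun x =>
    sZ (decide (Odd (u x / 2))) * (1 - 4 * (if (Odd (u x / 2) ↔ Odd (u x / 2 / 2)) then 1 else 0)) with hτ₀def
  have hτ₀val : ∀ x, τ₀ x = 1 ∨ τ₀ x = -1 ∨ τ₀ x = 3 ∨ τ₀ x = -3 := by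
    intro x
    simp only [τ₀]
    rcases tp_sZ_cases (decide (Odd (u x / 2))) with h | h <;> rw [h] <;> split_ifs <;> norm_num
  have hτ₀sq : ∀ x, τ₀ x ^ 2 = 1 + 8 * (if (Odd (u x / 2) ↔ Odd (u x / 2 / 2)) then 1 else 0 : ℤ) := by
    intro x
    simp only [τ₀]
    rcases tp_sZ_cases (decide (Odd (u x / 2))) with h | h <;> rw [h] <;> split_ifs <;> norm_num
  have hsumE : (∑ x, (if (Odd (u x / 2) ↔ Odd (u x / 2 / 2)) then 1 else 0 : ℤ)) = 768 := by
    rw [sum_boole]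
    exact_mod_cast hE
  have hsumτ₀ : ∑ x, τ₀ x ^ 2 = 10240 := by
    rw [sum_congr rfl fun x _ => hτ₀sq x, sum_add_distrib, ← mul_sum, hsumE, sum_const, card_univ, Fintype.card_fun,
      Fintype.card_bool, Fintype.card_fin]
    norm_num
  -- budget `Σ τ² = 12288`, excess `Σ X = 2048`
  have hbud := tw12_budget f g u hu
  have hT : (∑ x, (u x - 4 * sZ (f x)) ^ 2 : ℤ) = 12288 := by
    have h' : ((∑ x, (u x - 4 * sZ (f x)) ^ 2 : ℤ) : ℝ) = 12288 := by rw [hbud, hΦeq]; norm_num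
    exact_mod_cast h'
  set X : (Fin (6 + 6) → Bool) → ℤ := fun x => (τ₀ x + 8 * v x) ^ 2 - τ₀ x ^ 2 with hXdef
  have hXnn : ∀ x, 0 ≤ X x := fun x => to12_excess_nonneg _ _ (hτ₀val x)
  have hTdec : (∑ x, (u x - 4 * sZ (f x)) ^ 2 : ℤ) = ∑ x, τ₀ x ^ 2 + ∑ x, X x := by
    rw [← sum_add_distrib]
    exact sum_congr rfl fun x _ => by rw [hvx x]; simp only [X]; ring
  have hXsum : ∑ x, X x = 2048 := by rw [hTdec, hsumτ₀] at hT; linarith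
  set O := univ.filter (fun y : Fin (6 + 6) → Bool => Odd (v y)) with hOdef
  have hc' : (128 : ℤ) ≤ #O := by exact_mod_cast hO128
  -- AT THE BOUNDARY: `#O = 128`, the excess sits on `O` with exactly `16` per point
  have hsplit : ∑ x, X x = ∑ x ∈ O, X x + ∑ x ∈ univ.filter (fun x => x ∉ O), X x := by
    rw [← sum_filter_add_sum_filter_not univ (fun x => x ∈ O)]
    congr 1
    exact sum_congr (by ext x; simp) fun _ _ => rfl
  have hO16 : ∀ x ∈ O, 16 ≤ X x := fun x hx => by
    have hvodd : Odd (v x) := (mem_filter.1 hx).2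
    have h1 : 1 ≤ v x ∨ v x ≤ -1 := by have := Int.odd_iff.1 hvodd; omega
    have h := to12_excess _ _ 1 (hτ₀val x) le_rfl h1
    simp only [X]
    linarith
  have h1O : (16 : ℤ) * #O ≤ ∑ x ∈ O, X x :=
    calc (16 : ℤ) * #O = ∑ x ∈ O, (16 : ℤ) := by rw [sum_const, nsmul_eq_mul]; ring
      _ ≤ ∑ x ∈ O, X x := sum_le_sum hO16
  have h2O : 0 ≤ ∑ x ∈ univ.filter (fun x => x ∉ O), X x := sum_nonneg fun x _ => hXnn x
  have hOcard : (#O : ℤ) = 128 := by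
    apply le_antisymm _ hc'
    linarith
  have hOsum : ∑ x ∈ O, X x = 2048 := by
    rw [hOcard] at h1O
    linarith
  have hoff0 : ∀ x, x ∉ O → X x = 0 := by
    have h0 : ∑ x ∈ univ.filter (fun x => x ∉ O), X x = 0 := by linarith
    exact fun x hx => (sum_eq_zero_iff_of_nonneg fun y _ => hXnn y).1 h0 x (mem_filter.2 ⟨mem_univ _, hx⟩)
  have hO16eq : ∀ x ∈ O, X x = 16 := by
    intro x hx
    by_contra hne
    have hgt : 17 ≤ X x := by have := hO16 x hx; omega
    have hrest : (16 : ℤ) * (#O - 1) ≤ ∑ y ∈ O.erase x, X y := by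
      calc (16 : ℤ) * (#O - 1) = ∑ y ∈ O.erase x, (16 : ℤ) := by
            rw [sum_const, nsmul_eq_mul, card_erase_of_mem hx]
            have : 1 ≤ #O := card_pos.2 ⟨x, hx⟩
            push_cast [Nat.cast_sub this]; ring
        _ ≤ ∑ y ∈ O.erase x, X y := sum_le_sum fun y hy => hO16 y (mem_of_mem_erase hy)
    have := Finset.sum_erase_add O X hx
    rw [hOcard] at hrest
    linarith
  refine ⟨hΦeq, v, hvx, fun x => ?_, ?_⟩
  · by_cases hx : x ∈ O
    · right
      have hodd' : Odd (v x) := (mem_filter.1 hx).2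
      have h16 := hO16eq x hx
      simp only [X] at h16
      have hv1 : v x = 1 ∨ v x = -1 := by
        have ht : -3 ≤ τ₀ x ∧ τ₀ x ≤ 3 := by rcases hτ₀val x with h | h | h | h <;> rw [h] <;> norm_num
        have h2 : ¬ (2 ≤ v x) := fun h2 => by
          nlinarith [mul_nonneg (sub_nonneg.2 h2) (by linarith : (0:ℤ) ≤ τ₀ x + 3), mul_nonneg (sub_nonneg.2 h2) (sub_nonneg.2 h2)]
        have h3 : ¬ (v x ≤ -2) := fun h3 => by
          nlinarith [mul_nonneg (by linarith : (0:ℤ) ≤ -2 - v x) (by linarith : (0:ℤ) ≤ 3 - τ₀ x),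
            mul_nonneg (by linarith : (0:ℤ) ≤ -2 - v x) (by linarith : (0:ℤ) ≤ -2 - v x)]
        have h0 := Int.odd_iff.1 hodd'
        omega
      refine ⟨hv1, ?_⟩
      change τ₀ x = -3 * v x
      rcases hv1 with h1 | h1 <;> rw [h1] at h16 ⊢ <;> rcases hτ₀val x with h | h | h | h <;> rw [h] at h16 ⊢ <;>
        norm_num at h16 <;> norm_num
    · left
      have hev : Even (v x) := Int.not_odd_iff_even.1 fun h => hx (mem_filter.2 ⟨mem_univ _, h⟩)
      have h0 := hoff0 x hx
      simp only [X] at h0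
      by_contra hne
      have h2 : 2 ≤ v x ∨ v x ≤ -2 := by obtain ⟨k, hk⟩ := hev; omega
      have := to12_excess _ _ 2 (hτ₀val x) (by norm_num) h2
      linarith
  · have hset : (univ.filter fun x => v x ≠ 0) = O := by
      apply filter_congr
      intro x _
      constructor
      · intro hne
        by_contra hxO
        have hev : Even (v x) := Int.not_odd_iff_even.1 hxO
        have h0 := hoff0 x (fun h => hxO (mem_filter.1 h).2)
        simp only [X] at h0
        have h2 : 2 ≤ v x ∨ v x ≤ -2 := by obtain ⟨k, hk⟩ := hev; omega
        have := to12_excess _ _ 2 (hτ₀val x) (by norm_num) h2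
        linarith
      · intro hodd' h0
        rw [h0] at hodd'
        exact absurd hodd' (by decide)
    rw [hset]
    exact_mod_cast hOcard

end Summit.QuantumAdvantage.QuantumAdvantage.Theorems.CubicForrelation.NearExactIsExact

end
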